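import Literature.AnabelianGeometry.EtaleTheta.Discharge.Sec2Cor219iiiHeartLocallyConstant
import Literature.AnabelianGeometry.EtaleTheta.SettingModelTateDoubleUnderline
import Literature.AnabelianGeometry.EtaleTheta.SettingModelTateYTheta
import Literature.AnabelianGeometry.EtaleTheta.SettingModelChiTwistedSections
import Literature.AnabelianGeometry.EtaleTheta.SettingModelChiDoubleUnderline
import Literature.AnabelianGeometry.EtaleTheta.CyclotomeTowerAllLevels
import HarnessLib

/-!
# [EtTh] Cor. 2.19 (iii) at the Tate model, the `hgen` input of the Δ_P-heart: a PARITY OBSTRUCTION at even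
# levels and the positive case at odd levels (row «COR219III-M1b», file 1a; proof-only)

S. Mochizuki, *The Étale Theta Function and its Frobenioid-theoretic Manifestations* [EtTh], Publ. RIMS **45**
(2009), §1 p. 12 ("`Δ^Θ_X := Δ_X/[Δ_X,[Δ_X,Δ_X]]`", "`(Ẑ(1) ≅) Δ_Θ`"), §2 Cor. 2.19 (iii) p. 64 (locators `p.N` =
PDF pages of the PRIMS text) [cite: MochizukiEtTh2009, Cor 2.19 (iii) p.64].  Cell `abc-iut`, row «COR219III-M1b»
(abc-iut-L6-lead gen 7, 2026-08-27 01:43Z; K-L6 / F-0650 custody of DAG nodes IUTchII:Prop1.5(i)(ii)), seat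
abc-iut-L1-t6 (gen 5).  PROOF-ONLY: no definition, no instance, no notation, no new named fact; every input of another
seat is consumed BY NAME (abc-iut-f-142's `heart_of_dense_of_zpowers` p477834; abc-iut-L6-d6's `cThetaχq` /
`toThetaq_eq_of_right_eq_one` / `exists_cThetaχq_eq_of_mem_ker`; abc-iut-w5-d171's `yCoordχq` / `yCoordχq_mem_range_sqHom`;
abc-iut-L2-d1's `Huuχq` / `GtpYdd_modelχq`; abc-iut-L2-t6's `levelHom_bPowGfp` / `bPowGfp_mem_dY_iff`;
abc-iut-L2-t8's `CyclotomeMod`; `card_MuN` / `MuN.pow_card_eq_one`).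

THE ROW.  abc-iut-f-142's `ThetaSetting.EtaleThetaData.DoubleUnderline.heart_of_dense_of_zpowers` (the level-`M`
Δ_P-heart of [EtTh] Cor. 2.19 (iii), generic over every §1 setting) reduces the heart to TWO model facts about a
chosen geometric `a ∈ Π^tp_X̲̲` and a geometric `b ∈ Π^tp_Ÿ̲̲`: (i) `hdense` and (ii) `hgen` : «the ℤ-powers of
`red_M θ⁅a⁻¹, b⁆` exhaust `μ_M`».  This file decides (ii) at the stage-2 («Tate shear») model `ThetaSetting.modelχq p i j`
(every `i`, every even `j`; the datum of record is `(i, j) = (1, 2)`), for EVERY `X̲̲`-choice `C`: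

* §1 `toTheta_commutatorElement_eq_cThetaχq` — the commutator of two geometric elements of `Π^tp_X`, the second of
  degree `0`, in the theta quotient: `θ⁅g, h⁆ = c^{ŷ(h)^{deg g}}` (Heisenberg: `z = x_g·y_h − x_h·y_g`,
  `Heis.commutatorElement_eq`, with `x_h = 0`);
* §2 **`exists_sq_eq_toTheta_comm_modelχq`** — for EVERY `C`, every `a ∈ C.Huu` with `aug a = 1` and every `b ∈ Π^tp_Ÿ̲̲`
  (`(D.GtpYdd).subgroupOf C.Huu` = the tower's `PiYdd`) with `aug b = 1`: `θ(a⁻¹ b a b⁻¹)` is the SQUARE of an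
  element of `l·Δ_Θ` — because `deg a ∈ l·ℤ` (`DoubleUnderline.toZ_eq`, axiom `map_toZ_Huu = l·ℤ`) and `ŷ(b) ∈ 2Ẑ`
  (`Π^tp_Ÿ = Π^tp_{Y₂}`: `GtpYdd_modelχq`, `yCoordχq_mem_range_sqHom`); hence
  **`not_forall_exists_zpow_red_comm_of_two_dvd`** — for `2 ∣ M` the hypothesis (ii) `hgen` is UNSATISFIABLE (the
  squares of the cyclic group `μ_M` of even order `M` are a proper subgroup: an element of order `2`, by Cauchy, shows
  that squaring is not injective, hence not surjective) — and its twin `not_hgen_thetaEnvTower_of_two_dvd` typed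
  literally on the binders of `heart_of_dense_of_zpowers`;
* §3 the ODD levels: `exists_zpow_red_cThetaχq_pow_eq` — the reduction `red_M (c^{ι(1)^l})` GENERATES `μ_M` at every
  level (density of `ι(ℤ)` in `Ẑ`, continuity and surjectivity of `red`); **`forall_exists_zpow_red_comm_of_odd`** —
  for odd `M`, a geometric `a` of degree EXACTLY `l` and a geometric `b` with `ŷ(b) = ι(1)²` satisfy `hgen`
  (`θ⁅a⁻¹, b⁆ = (c^{ι(1)^l})^{−2}` and `2` is invertible mod `M`); §4 the explicit pair at the `X̲̲`-choice of record
  `C.Huu = Huuχq p i j l` — `a₀ := inl(â^l)`, `b₀ := inl(b̂^{ι(1)²})` — lies where it should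
  (`inl_gfpOf_zpow_mem_Huuχq`, `inl_bPowGfp_mem_Huuχq`, `inl_bPowGfp_sq_mem_GtpYdd_modelχq`, `toAdd_gfpSnd_gfpOf_zpow`,
  `yCoordχq_inl_bPowGfp`) and **`forall_exists_zpow_red_comm_record_of_odd`** — `hgen` HOLDS there at every ODD level.

CONSEQUENCE FOR THE ROW (numbers, not adjectives): abc-iut-f-142's route (b1) ⟸ (i) + (ii) is available at the Tate
datum at ODD levels only; at EVEN levels the heart needs the weaker single-value form of `honto` isolated by
`heart_of_uniqueness_of_onto'` (is the discrepancy `red_M(F b)·red_M(f b)⁻¹` a square?), a separate model question.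
HONEST LABEL: statements about the SEMI-SYNTHETIC stage-2 model of OUR typed §1 interface (binder-discharge evidence),
NOT about the tempered fundamental group of a curve; nothing of [EtTh] (refereed) is asserted or denied for a curve; no
side is taken on [IUTchIII] Cor. 3.12; typed ≠ proved; instantiated ≠ endorsed.
-/

noncomputable section

namespace Literature.AnabelianGeometry.EtaleTheta.SettingModel

open Literature.AnabelianGeometry.SemiGraphs _root_.Function
open scoped commutatorElement

variable (p : ℕ) [Fact p.Prime] (i j : ℤ)

/-! ## §1 The commutator of geometric elements in the theta quotient of the stage-2 model -/

/-- **`θ⁅g, h⁆ = c^{ŷ(h)^{deg g}}`** for geometric `g, h ∈ Π^tp_X` (`G`-component `1`) with `h` of degree `0`: in the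
Heisenberg shadow the commutator has centre coordinate `x_g·y_h − x_h·y_g = x_g·y_h` (`Heis.commutatorElement_eq`),
read at every level `N` and glued by abc-iut-L6-d6's `toThetaq_eq_of_right_eq_one`. [cite: MochizukiEtTh2009, §1 p.12] -/
theorem toTheta_commutatorElement_eq_cThetaχq (g h : PiTpχq p i j) (hg : g.right = 1) (hh : h.right = 1)
    (hZ : gfpSnd h.left = 1) :
    CurveTheta.toTheta (curveχq p i j) ⁅g, h⁆ =
      cThetaχq p i j (yCoordχq p i j h ^ (Multiplicative.toAdd (gfpSnd g.left) : ℤ)) := by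
  have hcomm : ⁅g, h⁆ = SemidirectProduct.inl ⁅g.left, h.left⁆ := by
    conv_lhs => rw [eq_inl_of_right_eq_oneq p i j hg, eq_inl_of_right_eq_oneq p i j hh]
    rw [← map_commutatorElement]
  rw [hcomm, cThetaχq_apply]
  refine toThetaq_eq_of_right_eq_one p i j _ _ (SemidirectProduct.right_inl _) (SemidirectProduct.right_inl _) ?_
  rw [SemidirectProduct.left_inl, SemidirectProduct.left_inl, gfpFst_cGfpχ, mem_closure_commutator₃_iff_forall_hHat]
  intro N
  -- coordinates at level `N`
  have hx : (hHat N (gfpFst h.left)).x = 0 := by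
    have h1 := hHat_x_eq_modN_eHat N (gfpFst h.left)
    rw [eHat_gfpFst_eq_one_of_gfpSnd hZ, map_one] at h1
    exact ofAdd_eq_one.mp h1
  have hgx : (hHat N (gfpFst g.left)).x = ((Multiplicative.toAdd (gfpSnd g.left) : ℤ) : ZMod N) := by
    have h1 := hHat_x_eq_modN_eHat N (gfpFst g.left)
    rw [gfpFst_apply, (mem_Gfp _).mp g.left.2, modN_iotaZ] at h1
    exact Multiplicative.ofAdd.injective h1
  have hy : (hHat N (gfpFst h.left)).y = Multiplicative.toAdd (modN N (yCoordχq p i j h)) := by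
    have h1 := hHat_y_eq_modN_eHatB N (gfpFst h.left)
    rw [yCoordχq_apply, ← h1, toAdd_ofAdd]
  rw [map_mul, map_inv, map_commutatorElement, map_commutatorElement, hHat_apply_of_cPowSpec _ powHat_commutator_spec,
    Heis.commutatorElement_eq, hx, hgx, hy, zero_mul, sub_zero, map_zpow, toAdd_zpow, zsmul_eq_mul]
  ext <;> simp

variable (hj : Even j)

/-! ## §2 Every `X̲̲`-choice: `θ⁅a⁻¹, b⁆` is a square in `l·Δ_Θ`; the parity obstruction to `hgen` at even levels -/

/-- **`θ(a⁻¹ b a b⁻¹) = d²` with `d ∈ l·Δ_Θ`**, for EVERY `X̲̲`-choice `C` over the stage-2 model, every `a ∈ Π^tp_X̲̲` with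
`aug a = 1` and every `b ∈ Π^tp_Ÿ̲̲` with `aug b = 1`: `deg a = l·k` (`DoubleUnderline.toZ_eq`) and `ŷ(b) = s²`
(`Π^tp_Ÿ = Π^tp_{Y₂}`, `yCoordχq_mem_range_sqHom`), so `θ⁅a⁻¹, b⁆ = c^{(s²)^{−lk}} = (c^{(s^{−k})^l})²`.
[cite: MochizukiEtTh2009, Cor 2.19 (iii) p.64] -/
theorem exists_sq_eq_toTheta_comm_modelχq {E : (ThetaSetting.modelχq p i j hj).EtaleThetaData} {l : ℕ}
    (C : E.DoubleUnderline l) (a : C.Huu)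
    (ha : (ThetaSetting.modelχq p i j hj).aug.toMonoidHom (a : (ThetaSetting.modelχq p i j hj).PiTemp) = 1)
    (b : ↥((ThetaSetting.modelχq p i j hj).GtpYdd.subgroupOf C.Huu))
    (hb : (ThetaSetting.modelχq p i j hj).aug.toMonoidHom ((b : C.Huu) : (ThetaSetting.modelχq p i j hj).PiTemp) = 1)
    (h₁ : (ThetaSetting.modelχq p i j hj).toTheta
      (((a : (ThetaSetting.modelχq p i j hj).PiTemp))⁻¹ * ((b : C.Huu) : (ThetaSetting.modelχq p i j hj).PiTemp) *
        (a : (ThetaSetting.modelχq p i j hj).PiTemp) * (((b : C.Huu) : (ThetaSetting.modelχq p i j hj).PiTemp))⁻¹) ∈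
      (ThetaSetting.modelχq p i j hj).lDeltaTheta l) :
    ∃ d : (ThetaSetting.modelχq p i j hj).lDeltaTheta l, d ^ 2 = ⟨_, h₁⟩ := by
  have ha' : (a : PiTpχq p i j).right = 1 := ha
  have hb' : ((b : C.Huu) : PiTpχq p i j).right = 1 := hb
  have hbY' : ((b : C.Huu) : PiTpχq p i j) ∈ (ThetaSetting.modelχq p i j hj).GtpYdd := b.2
  have hbY : ((b : C.Huu) : PiTpχq p i j) ∈ YNχq p i j 2 := (GtpYdd_modelχq p i j hj).le hbY'
  obtain ⟨⟨hbZ, hbax⟩, -⟩ := (GfpTwistData₀.mem_YN _).mp hbY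
  have hZ : gfpSnd ((b : C.Huu) : PiTpχq p i j).left = 1 := hbZ
  have hy0 : (hHat 2 (gfpFst ((b : C.Huu) : PiTpχq p i j).left)).y = 0 := hbax.2
  obtain ⟨s, hs⟩ := yCoordχq_mem_range_sqHom p i j hy0
  have hxa : (Multiplicative.toAdd (gfpSnd (a : PiTpχq p i j).left) : ℤ) = l * C.zExp a := C.toZ_eq a
  have hcomm : (ThetaSetting.modelχq p i j hj).toTheta
      (((a : (ThetaSetting.modelχq p i j hj).PiTemp))⁻¹ * ((b : C.Huu) : (ThetaSetting.modelχq p i j hj).PiTemp) *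
        (a : (ThetaSetting.modelχq p i j hj).PiTemp) * (((b : C.Huu) : (ThetaSetting.modelχq p i j hj).PiTemp))⁻¹) =
      CurveTheta.toTheta (curveχq p i j) ⁅((a : PiTpχq p i j))⁻¹, ((b : C.Huu) : PiTpχq p i j)⁆ := by
    rw [commutatorElement_def, inv_inv]
  have hA := toTheta_commutatorElement_eq_cThetaχq p i j ((a : PiTpχq p i j))⁻¹ ((b : C.Huu) : PiTpχq p i j)
    (by rw [SemidirectProduct.inv_right, ha', inv_one]) hb' hZ
  have hinvleft : ((a : PiTpχq p i j)⁻¹).left = ((a : PiTpχq p i j).left)⁻¹ := by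
    rw [SemidirectProduct.inv_left, ha', inv_one, map_one, MulAut.one_apply]
  refine ⟨⟨cThetaχq p i j ((s ^ (-(C.zExp a))) ^ l),
    ⟨cThetaχq p i j (s ^ (-(C.zExp a))), cThetaχq_mem_ker p i j _, by rw [map_pow]⟩⟩, ?_⟩
  apply Subtype.ext
  show (cThetaχq p i j ((s ^ (-(C.zExp a))) ^ l)) ^ 2 = (ThetaSetting.modelχq p i j hj).toTheta _
  rw [hcomm, hA, hinvleft, map_inv, toAdd_inv, hxa, ← hs, sqHom_apply, ← map_pow]
  congr 1
  rw [← zpow_natCast, ← zpow_natCast, ← zpow_mul, ← zpow_mul, ← zpow_natCast, ← zpow_mul]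
  congr 1
  push_cast
  ring

/-- **PARITY OBSTRUCTION: at an EVEN level `M` the hypothesis `hgen` of abc-iut-f-142's `heart_of_dense_of_zpowers` is
UNSATISFIABLE at the stage-2 model** — for EVERY `X̲̲`-choice `C`, every geometric `a ∈ Π^tp_X̲̲`, every geometric
`b ∈ Π^tp_Ÿ̲̲` and every cyclotome tower `τ`: `red_M θ⁅a⁻¹, b⁆ = (red_M d)²` is a square in the cyclic group `μ_M` of
even order (`card_MuN`), whose squares form a proper subgroup (an element of order `2` — Cauchy — makes `u ↦ u²`
non-injective, hence non-surjective on the finite `μ_M`), so no power of it reaches a non-square.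
[cite: MochizukiEtTh2009, Cor 2.19 (iii) p.64] -/
theorem not_forall_exists_zpow_red_comm_of_two_dvd {E : (ThetaSetting.modelχq p i j hj).EtaleThetaData} {l : ℕ}
    (C : E.DoubleUnderline l) {Es : Set ℕ+} (τ : (ThetaSetting.modelχq p i j hj).CyclotomeTower l Es) (M : Es)
    (hM : 2 ∣ ((M : ℕ+) : ℕ)) (a : C.Huu)
    (ha : (ThetaSetting.modelχq p i j hj).aug.toMonoidHom (a : (ThetaSetting.modelχq p i j hj).PiTemp) = 1)
    (b : ↥((ThetaSetting.modelχq p i j hj).GtpYdd.subgroupOf C.Huu))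
    (hb : (ThetaSetting.modelχq p i j hj).aug.toMonoidHom ((b : C.Huu) : (ThetaSetting.modelχq p i j hj).PiTemp) = 1)
    (h₁ : (ThetaSetting.modelχq p i j hj).toTheta
      (((a : (ThetaSetting.modelχq p i j hj).PiTemp))⁻¹ * ((b : C.Huu) : (ThetaSetting.modelχq p i j hj).PiTemp) *
        (a : (ThetaSetting.modelχq p i j hj).PiTemp) * (((b : C.Huu) : (ThetaSetting.modelχq p i j hj).PiTemp))⁻¹) ∈
      (ThetaSetting.modelχq p i j hj).lDeltaTheta l) :
    ¬ ∀ u : MuN p M, ∃ m : ℤ, ((τ.mod M).red ⟨_, h₁⟩) ^ m = u := by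
  obtain ⟨d, hd⟩ := exists_sq_eq_toTheta_comm_modelχq p i j hj C a ha b hb h₁
  rw [← hd, map_pow]
  intro H
  have hsurj : Function.Surjective fun u : MuN p M => u ^ 2 := fun u => by
    obtain ⟨m, hm⟩ := H u
    exact ⟨((τ.mod M).red d) ^ m, by
      dsimp only
      rw [← zpow_natCast, ← zpow_mul, mul_comm, zpow_mul, zpow_natCast, hm]⟩
  have hinj : Function.Injective fun u : MuN p M => u ^ 2 := Finite.injective_iff_surjective.mpr hsurj
  haveI : Fact (Nat.Prime 2) := ⟨Nat.prime_two⟩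
  obtain ⟨g, hg⟩ := exists_prime_orderOf_dvd_card (G := MuN p M) 2 (by rw [card_MuN]; exact hM)
  have hg1 : g ≠ 1 := fun h => by
    rw [h, orderOf_one] at hg
    exact absurd hg (by decide)
  have hg2 : g ^ 2 = 1 := by rw [← hg, pow_orderOf_eq_one]
  exact hg1 (hinj (by simp only [hg2, one_pow]))

/-- The parity obstruction typed LITERALLY on the binders of abc-iut-f-142's `heart_of_dense_of_zpowers` (p477834):
`b : (C.thetaEnvTower τ hC hS).PiYdd`, the commutator hypothesis `h₁`, the conclusion `hgen` — negated for `2 ∣ M`.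
[cite: MochizukiEtTh2009, Cor 2.19 (iii) p.64] -/
theorem not_hgen_thetaEnvTower_of_two_dvd {E : (ThetaSetting.modelχq p i j hj).EtaleThetaData} {l : ℕ}
    (C : E.DoubleUnderline l) {Es : Set ℕ+} (τ : (ThetaSetting.modelχq p i j hj).CyclotomeTower l Es)
    (hC : (ThetaSetting.modelχq p i j hj).Compat) (hS : (ThetaSetting.modelχq p i j hj).Sec2Hyps) (M : Es)
    (hM : 2 ∣ ((M : ℕ+) : ℕ)) (a : C.Huu)
    (ha : (ThetaSetting.modelχq p i j hj).aug.toMonoidHom (a : (ThetaSetting.modelχq p i j hj).PiTemp) = 1)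
    (b : (C.thetaEnvTower τ hC hS).PiYdd)
    (hb : (ThetaSetting.modelχq p i j hj).aug.toMonoidHom ((b : C.Huu) : (ThetaSetting.modelχq p i j hj).PiTemp) = 1)
    (h₁ : (ThetaSetting.modelχq p i j hj).toTheta
      (((a : (ThetaSetting.modelχq p i j hj).PiTemp))⁻¹ * ((b : C.Huu) : (ThetaSetting.modelχq p i j hj).PiTemp) *
        (a : (ThetaSetting.modelχq p i j hj).PiTemp) * (((b : C.Huu) : (ThetaSetting.modelχq p i j hj).PiTemp))⁻¹) ∈
      (ThetaSetting.modelχq p i j hj).lDeltaTheta l) :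
    ¬ ∀ u : MuN p M, ∃ m : ℤ, ((τ.mod M).red ⟨_, h₁⟩) ^ m = u :=
  not_forall_exists_zpow_red_comm_of_two_dvd p i j hj C τ M hM a ha b hb h₁


/-! ## §3 Odd levels: `red_M (c^{ι(1)^l})` generates `μ_M`; `hgen` for a degree-`l` / `ŷ = ι(1)²` pair -/

/-- **`red_M (c^{ι(1)^l})` GENERATES `μ_M`** at every level `M` of every cyclotome tower `τ` over the stage-2 model: every
`u ∈ μ_M` is `red_M (c^{s^l})` for some `s ∈ Ẑ` (`red` onto, `l·Δ_Θ = (c^Ẑ)^l` by abc-iut-L6-d6's `exists_cThetaχq_eq_of_mem_ker`),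
the fibre `{s | red_M (c^{s^l}) = u}` is open (`red` and `s ↦ c^{s^l}` continuous, `μ_M` discrete) and meets the dense
`ι(ℤ)`; on `ι(n)` the value is `red_M (c^{ι(1)^l})^n`. [cite: MochizukiEtTh2009, §1 p.12] -/
theorem exists_zpow_red_cThetaχq_pow_eq {l : ℕ} {Es : Set ℕ+}
    (τ : (ThetaSetting.modelχq p i j hj).CyclotomeTower l Es) (M : Es) (u : MuN p M) :
    ∃ n : ℤ, ((τ.mod M).red ⟨cThetaχq p i j ((iotaZ (Multiplicative.ofAdd 1)) ^ l),
      ⟨cThetaχq p i j (iotaZ (Multiplicative.ofAdd 1)), cThetaχq_mem_ker p i j _, by rw [map_pow]⟩⟩) ^ n = u := by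
  -- the continuous map `s ↦ red (c^{s^l})`
  let φ : ZH → MuN p M := fun s => (τ.mod M).red ⟨cThetaχq p i j (s ^ l),
    ⟨cThetaχq p i j s, cThetaχq_mem_ker p i j _, by rw [map_pow]⟩⟩
  have hφ : Continuous φ :=
    (τ.mod M).continuous_red.comp (((cThetaχq p i j).continuous.comp (continuous_pow l)).subtype_mk _)
  -- `u` is hit by some `s : Ẑ`
  obtain ⟨x, hx⟩ := (τ.mod M).red_surjective u
  obtain ⟨y, hy, hyl⟩ := x.2
  obtain ⟨t, ht⟩ := exists_cThetaχq_eq_of_mem_ker p i j hy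
  have htu : φ t = u := by
    rw [← hx]
    show (τ.mod M).red _ = _
    congr 1
    exact Subtype.ext (show cThetaχq p i j (t ^ l) = (x : (ThetaSetting.modelχq p i j hj).GtpTheta) by
      rw [map_pow, ht, hyl])
  -- density of `ι(ℤ)`: some integer lands in the open fibre `φ⁻¹ {u}`
  have hdense : DenseRange iotaZ :=
    ProfiniteGrp.ProfiniteCompletion.denseRange (G := GrpCat.of (Multiplicative ℤ))
  obtain ⟨n, hn⟩ := hdense.exists_mem_open ((isOpen_discrete {u}).preimage hφ) ⟨t, htu⟩
  refine ⟨Multiplicative.toAdd n, ?_⟩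
  have hn' : φ (iotaZ n) = u := hn
  rw [← hn', ← map_zpow]
  show (τ.mod M).red _ = (τ.mod M).red _
  congr 1
  apply Subtype.ext
  show (cThetaχq p i j ((iotaZ (Multiplicative.ofAdd 1)) ^ l)) ^ Multiplicative.toAdd n = cThetaχq p i j ((iotaZ n) ^ l)
  rw [← map_zpow, ← zpow_natCast, ← zpow_natCast, ← zpow_mul, mul_comm, zpow_mul, ← map_zpow]
  congr 2
  rw [← ofAdd_zsmul, smul_eq_mul, mul_one, ofAdd_toAdd]

/-- **`hgen` at ODD levels**: for EVERY `X̲̲`-choice `C`, a geometric `a ∈ Π^tp_X̲̲` of degree EXACTLY `l` and a geometric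
`b ∈ Π^tp_Ÿ̲̲` with `ŷ(b) = ι(1)²` have `θ⁅a⁻¹, b⁆ = (c^{ι(1)^l})^{−2}`, whose reduction generates `μ_M` when `M` is odd
(`2·(r+1) = M + 1` and `u^M = 1`, `MuN.pow_card_eq_one`). [cite: MochizukiEtTh2009, Cor 2.19 (iii) p.64] -/
theorem forall_exists_zpow_red_comm_of_odd {E : (ThetaSetting.modelχq p i j hj).EtaleThetaData} {l : ℕ}
    (C : E.DoubleUnderline l) {Es : Set ℕ+} (τ : (ThetaSetting.modelχq p i j hj).CyclotomeTower l Es) (M : Es)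
    (hM : Odd ((M : ℕ+) : ℕ)) (a : C.Huu)
    (ha : (ThetaSetting.modelχq p i j hj).aug.toMonoidHom (a : (ThetaSetting.modelχq p i j hj).PiTemp) = 1)
    (hdeg : Multiplicative.toAdd (gfpSnd (a : PiTpχq p i j).left) = (l : ℤ))
    (b : ↥((ThetaSetting.modelχq p i j hj).GtpYdd.subgroupOf C.Huu))
    (hb : (ThetaSetting.modelχq p i j hj).aug.toMonoidHom ((b : C.Huu) : (ThetaSetting.modelχq p i j hj).PiTemp) = 1)
    (hyb : yCoordχq p i j ((b : C.Huu) : PiTpχq p i j) = (iotaZ (Multiplicative.ofAdd 1)) ^ 2)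
    (h₁ : (ThetaSetting.modelχq p i j hj).toTheta
      (((a : (ThetaSetting.modelχq p i j hj).PiTemp))⁻¹ * ((b : C.Huu) : (ThetaSetting.modelχq p i j hj).PiTemp) *
        (a : (ThetaSetting.modelχq p i j hj).PiTemp) * (((b : C.Huu) : (ThetaSetting.modelχq p i j hj).PiTemp))⁻¹) ∈
      (ThetaSetting.modelχq p i j hj).lDeltaTheta l) :
    ∀ u : MuN p M, ∃ m : ℤ, ((τ.mod M).red ⟨_, h₁⟩) ^ m = u := by
  have ha' : (a : PiTpχq p i j).right = 1 := ha
  have hb' : ((b : C.Huu) : PiTpχq p i j).right = 1 := hb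
  have hbY' : ((b : C.Huu) : PiTpχq p i j) ∈ (ThetaSetting.modelχq p i j hj).GtpYdd := b.2
  have hbY : ((b : C.Huu) : PiTpχq p i j) ∈ YNχq p i j 2 := (GtpYdd_modelχq p i j hj).le hbY'
  obtain ⟨⟨hbZ, -⟩, -⟩ := (GfpTwistData₀.mem_YN _).mp hbY
  have hZ : gfpSnd ((b : C.Huu) : PiTpχq p i j).left = 1 := hbZ
  have hcomm : (ThetaSetting.modelχq p i j hj).toTheta
      (((a : (ThetaSetting.modelχq p i j hj).PiTemp))⁻¹ * ((b : C.Huu) : (ThetaSetting.modelχq p i j hj).PiTemp) *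
        (a : (ThetaSetting.modelχq p i j hj).PiTemp) * (((b : C.Huu) : (ThetaSetting.modelχq p i j hj).PiTemp))⁻¹) =
      CurveTheta.toTheta (curveχq p i j) ⁅((a : PiTpχq p i j))⁻¹, ((b : C.Huu) : PiTpχq p i j)⁆ := by
    rw [commutatorElement_def, inv_inv]
  have hA := toTheta_commutatorElement_eq_cThetaχq p i j ((a : PiTpχq p i j))⁻¹ ((b : C.Huu) : PiTpχq p i j)
    (by rw [SemidirectProduct.inv_right, ha', inv_one]) hb' hZ
  have hinvleft : ((a : PiTpχq p i j)⁻¹).left = ((a : PiTpχq p i j).left)⁻¹ := by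
    rw [SemidirectProduct.inv_left, ha', inv_one, map_one, MulAut.one_apply]
  -- `⟨θ⁅a⁻¹,b⁆, h₁⟩ = x₀ ^ (-2)` with `x₀ = c^{ι(1)^l}`
  have hx₀ : (⟨_, h₁⟩ : (ThetaSetting.modelχq p i j hj).lDeltaTheta l) =
      (⟨cThetaχq p i j ((iotaZ (Multiplicative.ofAdd 1)) ^ l),
        ⟨cThetaχq p i j (iotaZ (Multiplicative.ofAdd 1)), cThetaχq_mem_ker p i j _, by rw [map_pow]⟩⟩) ^ (-2 : ℤ) := by
    apply Subtype.ext
    show (ThetaSetting.modelχq p i j hj).toTheta _ = (cThetaχq p i j ((iotaZ (Multiplicative.ofAdd 1)) ^ l)) ^ (-2 : ℤ)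
    rw [hcomm, hA, hinvleft, map_inv, toAdd_inv, hdeg, hyb, ← map_zpow]
    congr 1
    rw [← zpow_natCast, ← zpow_natCast, ← zpow_mul, ← zpow_mul]
    congr 1
    ring
  intro u
  obtain ⟨n, hn⟩ := exists_zpow_red_cThetaχq_pow_eq p i j hj τ M u
  obtain ⟨r, hr⟩ := hM
  -- `2 (r + 1) = M + 1`, so `x ↦ x^{-2}` is undone by `x ↦ x^{-(r+1)}` modulo `x^M = 1`
  refine ⟨-(n * (r + 1 : ℕ)), ?_⟩
  rw [hx₀, map_zpow, ← hn, ← zpow_mul]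
  have hM1 : ((τ.mod M).red ⟨cThetaχq p i j ((iotaZ (Multiplicative.ofAdd 1)) ^ l),
      ⟨cThetaχq p i j (iotaZ (Multiplicative.ofAdd 1)), cThetaχq_mem_ker p i j _, by rw [map_pow]⟩⟩) ^
      (((M : ℕ+) : ℕ) : ℤ) = 1 := by
    rw [zpow_natCast]
    exact MuN.pow_card_eq_one p M _
  have hexp : (-2 : ℤ) * -(n * ((r + 1 : ℕ) : ℤ)) = n + n * (((M : ℕ+) : ℕ) : ℤ) := by
    push_cast
    rw [hr]
    push_cast
    ring
  rw [hexp, zpow_add, mul_comm n (((M : ℕ+) : ℕ) : ℤ), zpow_mul, hM1, one_zpow, mul_one]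

/-! ## §4 The explicit pair at the `X̲̲`-choice of record `Π^tp_X̲̲ = Huuχq` -/

/-- `a₀ := inl(â^l) ∈ Π^tp_X̲̲ = Huuχq p i j l` (its Heisenberg level-`l` image is `(l, 0, 0) = 1`).
[cite: MochizukiEtTh2009, Def 2.5 (i) p.39] -/
theorem inl_gfpOf_zpow_mem_Huuχq (l : ℕ+) (hl : Odd (l : ℕ)) :
    (SemidirectProduct.inl (gfpOf (FreeGroup.of 0 ^ ((l : ℕ) : ℤ))) : PiTpχq p i j) ∈ Huuχq p i j l hl := by
  rw [mem_Huuχq_iff, SemidirectProduct.left_inl, levelHom_gfpOf_of_zero_zpow]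
  exact ⟨by simp, rfl⟩

/-- `inl(b̂^t) ∈ Π^tp_X̲̲ = Huuχq p i j l` for every `t ∈ Ẑ` (level image `(0, t, 0)`).
[cite: MochizukiEtTh2009, Def 2.5 (i) p.39] -/
theorem inl_bPowGfp_mem_Huuχq (l : ℕ+) (hl : Odd (l : ℕ)) (t : ZH) :
    (SemidirectProduct.inl (bPowGfp t) : PiTpχq p i j) ∈ Huuχq p i j l hl := by
  rw [mem_Huuχq_iff, SemidirectProduct.left_inl, levelHom_bPowGfp]
  exact ⟨rfl, rfl⟩

/-- `inl(b̂^{s²}) ∈ Π^tp_Ÿ = Π^tp_{Y₂}` at the stage-2 model (degree `0`, level-`2` `y`-coordinate `2s ≡ 0`, `G`-component `1`).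
[cite: MochizukiEtTh2009, §1 p.17] -/
theorem inl_bPowGfp_sq_mem_GtpYdd_modelχq (s : ZH) :
    (SemidirectProduct.inl (bPowGfp (s ^ 2)) : PiTpχq p i j) ∈ (ThetaSetting.modelχq p i j hj).GtpYdd := by
  rw [GtpYdd_modelχq]
  refine (GfpTwistData₀.mem_YN _).mpr ⟨?_, ?_⟩
  · rw [SemidirectProduct.left_inl, bPowGfp_mem_dY_iff, map_pow]
    have h2 : ∀ x : Multiplicative (ZMod 2), x ^ 2 = 1 := by decide
    exact h2 _
  · rw [SemidirectProduct.right_inl]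
    exact one_mem _

/-- `deg(â^k) = k`. [cite: MochizukiEtTh2009, §1 p.12] -/
theorem toAdd_gfpSnd_gfpOf_zpow (k : ℤ) :
    Multiplicative.toAdd (gfpSnd (gfpOf (FreeGroup.of 0 ^ k))) = k := by
  rw [gfpSnd_gfpOf, expA_of_zero_zpow, toAdd_ofAdd]

/-- **`hgen` HOLDS at every ODD level for the explicit pair `(a₀, b₀) = (inl â^l, inl b̂^{ι(1)²})` at the `X̲̲`-choice of
record** (`C.Huu = Huuχq p i j l`; e.g. abc-iut-L2-d1's `doubleUnderlineχqOfEtaRes`): the input (ii) of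
abc-iut-f-142's `heart_of_dense_of_zpowers` is available there for odd `M` (and, by §2, for no pair at all when `M` is even).
[cite: MochizukiEtTh2009, Cor 2.19 (iii) p.64] -/
theorem forall_exists_zpow_red_comm_record_of_odd {E : (ThetaSetting.modelχq p i j hj).EtaleThetaData} {l : ℕ+}
    (hl : Odd (l : ℕ)) (C : E.DoubleUnderline l) (hHuu : C.Huu = Huuχq p i j l hl) {Es : Set ℕ+}
    (τ : (ThetaSetting.modelχq p i j hj).CyclotomeTower l Es) (M : Es) (hM : Odd ((M : ℕ+) : ℕ))
    (h₁ : (ThetaSetting.modelχq p i j hj).toTheta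
      (((SemidirectProduct.inl (gfpOf (FreeGroup.of 0 ^ ((l : ℕ) : ℤ))) : PiTpχq p i j))⁻¹ *
        (SemidirectProduct.inl (bPowGfp ((iotaZ (Multiplicative.ofAdd 1)) ^ 2)) : PiTpχq p i j) *
        (SemidirectProduct.inl (gfpOf (FreeGroup.of 0 ^ ((l : ℕ) : ℤ))) : PiTpχq p i j) *
        ((SemidirectProduct.inl (bPowGfp ((iotaZ (Multiplicative.ofAdd 1)) ^ 2)) : PiTpχq p i j))⁻¹) ∈
      (ThetaSetting.modelχq p i j hj).lDeltaTheta l) :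
    ∀ u : MuN p M, ∃ m : ℤ, ((τ.mod M).red ⟨_, h₁⟩) ^ m = u :=
  forall_exists_zpow_red_comm_of_odd p i j hj C τ M hM
    ⟨SemidirectProduct.inl (gfpOf (FreeGroup.of 0 ^ ((l : ℕ) : ℤ))), hHuu.ge (inl_gfpOf_zpow_mem_Huuχq p i j l hl)⟩
    (SemidirectProduct.right_inl (N := Gfp) (G := GQp p) (φ := actχq p i j) (gfpOf (FreeGroup.of 0 ^ ((l : ℕ) : ℤ))))
    (toAdd_gfpSnd_gfpOf_zpow _)
    ⟨⟨SemidirectProduct.inl (bPowGfp ((iotaZ (Multiplicative.ofAdd 1)) ^ 2)), hHuu.ge (inl_bPowGfp_mem_Huuχq p i j l hl _)⟩,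
      inl_bPowGfp_sq_mem_GtpYdd_modelχq p i j hj _⟩
    (SemidirectProduct.right_inl (N := Gfp) (G := GQp p) (φ := actχq p i j) (bPowGfp ((iotaZ (Multiplicative.ofAdd 1)) ^ 2)))
    (yCoordχq_inl_bPowGfp p i j _) h₁


end Literature.AnabelianGeometry.EtaleTheta.SettingModel

end
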